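import Summits.RiemannHypothesis.RiemannHypothesis.Theorems.S2FormatCBridge
import Summits.RiemannHypothesis.RiemannHypothesis.Theorems.WeilFormatCWindowDictionaryTwo
import HarnessLib

/-!
# Format C at `S = {∞, 2}` — the SECTOR REDUCTION is a theorem (Schur-complement step, generic linear algebra)

Seat cc-s2-4 gen3 (`HOME/cc-s2-4/CC4-LEAN.md` §9.10).  `S2FormatC.SectorReductionTwo D b` (§5 of `S2FormatCShapes`:
far coercivity + column tail + `0 < γ ≤ γ_far` + the (P)+(E) block step `xᵀ(U/γ)x ≤ xᵀG_Wx` ⇒ every truncated real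
sector form is non-negative) holds for EVERY sector datum `D` and window `b`: split the modes `≤ N` into the block
modes (`≤ M₁`) and the far modes `(M₁, N]`, write the truncated form as `xᵀGx + 2Σ_m c_m y_m + (far form)` using the
symmetry of the `{∞,2}` Gram matrix (`gram_symm`), bound the far form below by `γ·Σ y_m²` (far coercivity, `γ ≤ γ_far`),
and apply weil-3's completed-square step `WeilFormatC.schurStepDiag_nonneg_of_farBound` with the column-tail
majorant (`coupling_le_tailU`).  Consequence `le_threshold_of_formatC₄`: a verified S = {2} certificate closes
`WeilSemilocalPositivityOn {2} b ∧ b ≤ a*({2})` modulo ONLY `FarCoercivityTwo` and `ColumnTailTwo` per sector (L-C3a/b)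
and the numeric side condition `0 < γ ≤ gammaFar`.
-/

set_option linter.dupNamespace false
set_option autoImplicit false

noncomputable section

open Complex Set MeasureTheory Filter Finset Matrix
open scoped Real Topology ComplexConjugate BigOperators

namespace Summit.RiemannHypothesis.RiemannHypothesis.Theorems.S2FormatC

open Literature.NumberTheory.LFunctions Literature.Analysis.SpecialFunctions
open Summit.RiemannHypothesis.RiemannHypothesis.Theorems.MotivicDoor.SemilocalThreshold

section Reduction

variable {b : ℝ}

/-! ### Symmetry of the `{∞,2}` Gram matrix -/

/-- `expsumOff` is symmetric. -/
theorem expsumOff_symm (b : ℝ) (n m : ℤ) : expsumOff b n m = expsumOff b m n := by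
  unfold expsumOff
  by_cases h : m = -n
  · have h' : n = -m := by rw [h, neg_neg]
    rw [if_pos h, if_pos h', h', S0_neg]
  · have h' : ¬(n = -m) := fun e ↦ h (by rw [e, neg_neg])
    rw [if_neg h, if_neg h']
    rw [show S2 b m - S2 b n - omega b m * omega b n * (S0 b m - S0 b n) =
        -(S2 b n - S2 b m - omega b n * omega b m * (S0 b n - S0 b m)) by ring,
      show omega b n ^ 2 - omega b m ^ 2 = -(omega b m ^ 2 - omega b n ^ 2) by ring, neg_div_neg_eq]

/-- **`G₂(n, m) = G₂(m, n)`**: the `{∞,2}` Gram matrix is symmetric. -/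
theorem gram_symm (b : ℝ) (n m : ℤ) : gram b n m = gram b m n := by
  have hpol : polarG b n m = polarG b m n := by unfold polarG; rw [add_comm n m]; ring
  have hpri : primeG b n m = primeG b m n := by
    unfold primeG
    by_cases h : n = m
    · subst h; rfl
    · have h' : ¬(m = n) := fun e ↦ h e.symm
      rw [if_neg h, if_neg h', show m - n = -(n - m) by ring, sgn_neg,
        show Real.sin (omega b n * Real.log 2) - Real.sin (omega b m * Real.log 2) =
          -(Real.sin (omega b m * Real.log 2) - Real.sin (omega b n * Real.log 2)) by ring]
      have e : (π * (((m : ℤ) : ℝ) - n)) = -(π * ((n : ℝ) - m)) := by ring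
      rw [e, div_neg]
      ring
  have harch : archG b n m = archG b m n := by
    unfold archG
    by_cases h : n = m
    · subst h; rfl
    · have h' : ¬(m = n) := fun e ↦ h e.symm
      rw [if_neg h, if_neg h', add_comm m n, expsumOff_symm b m n,
        show imPsi b m - imPsi b n = -(imPsi b n - imPsi b m) by ring]
      have e : (π * (((m : ℤ) : ℝ) - n)) = -(π * ((n : ℝ) - m)) := by ring
      rw [e, div_neg]
      ring
  unfold gram
  rw [hpol, hpri, harch]
  by_cases h : n = m
  · subst h; rfl
  · have h' : ¬(m = n) := fun e ↦ h e.symm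
    rw [if_neg h, if_neg h']

/-- The sector Gram matrices `W^σ` are symmetric. -/
theorem gramSector_symm (odd : Bool) (b : ℝ) (n m : ℕ) : gramSector odd b n m = gramSector odd b m n := by
  have key : gram b n m + gram b n (-(m : ℤ)) = gram b m n + gram b m (-(n : ℤ)) := by
    rw [gram_symm b n m, gram_symm b n (-(m : ℤ)), ← gram_refl b (-(m : ℤ)) n, neg_neg]
  have key' : gram b n m - gram b n (-(m : ℤ)) = gram b m n - gram b m (-(n : ℤ)) := by
    rw [gram_symm b n m, gram_symm b n (-(m : ℤ)), ← gram_refl b (-(m : ℤ)) n, neg_neg]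
  unfold gramSector gramOdd gramEven
  cases odd
  · simp only [Bool.false_eq_true, if_false]
    by_cases hn : n = 0 <;> by_cases hm : m = 0
    · subst hn; subst hm; simp
    · subst hn; simp [hm]; rw [gram_symm]
    · subst hm; simp [hn]; rw [gram_symm]
    · simp only [hn, hm, and_self, if_false]; exact key
  · simp only [if_true]; exact key'

/-! ### Index bookkeeping: block indices `Fin D.dim` ↔ block modes `sectorModes D.odd D.M₁` -/

/-- `Σ_{i : Fin dim} f(mode i) = Σ_{n ∈ sectorModes odd M₁} f n`. -/
theorem sum_fin_mode (D : SectorData) (f : ℕ → ℝ) :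
    ∑ i : Fin D.dim, f (D.mode i) = ∑ n ∈ sectorModes D.odd D.M₁, f n := by
  have h1 : ∑ i : Fin D.dim, f (D.mode i) = ∑ i ∈ range D.dim, f (if D.odd then i + 1 else i) :=
    Fin.sum_univ_eq_sum_range (fun i ↦ f (if D.odd then i + 1 else i)) D.dim
  rw [h1]
  unfold SectorData.dim sectorModes
  cases D.odd
  · simp
  · simp only [if_true]
    have e1 : Finset.Icc 1 D.M₁ = Finset.image (fun k ↦ k + 1) (Finset.range D.M₁) := by
      ext n
      simp only [Finset.mem_Icc, Finset.mem_image, Finset.mem_range]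
      constructor
      · rintro ⟨h1, h2⟩; exact ⟨n - 1, by omega, by omega⟩
      · rintro ⟨k, hk, rfl⟩; omega
    rw [e1, Finset.sum_image (fun a _ b _ hab ↦ by omega)]

/-- Block modes are `≤ M₁`. -/
theorem mem_sectorModes_le {odd : Bool} {M n : ℕ} (h : n ∈ sectorModes odd M) : n ≤ M := by
  unfold sectorModes at h; split_ifs at h <;> simp at h <;> omega

/-- The modes `≤ N` lie in the block modes plus the far modes `(M₁, N]`. -/
theorem sectorModes_subset_union (odd : Bool) (M₁ N : ℕ) :
    sectorModes odd N ⊆ sectorModes odd M₁ ∪ Finset.Ioc M₁ N := by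
  unfold sectorModes; split_ifs <;> intro n hn <;> simp at hn ⊢ <;> omega

/-- Block modes and far modes are disjoint. -/
theorem disjoint_sectorModes_Ioc (odd : Bool) (M₁ N : ℕ) : Disjoint (sectorModes odd M₁) (Finset.Ioc M₁ N) := by
  rw [Finset.disjoint_left]
  intro n hn hn'
  have := mem_sectorModes_le hn
  simp at hn'; omega

/-- Splitting a symmetric real double sum over a disjoint union `P ∪ Q` into block, cross and far parts:
`Σ_{P∪Q}Σ_{P∪Q} z_n z_m W(n,m) = Σ_PΣ_P + 2 Σ_{m∈Q} (Σ_{n∈P} z_n W(n,m)) z_m + Σ_QΣ_Q`. -/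
theorem sum_union_sum_union_of_symm (P Q : Finset ℕ) (hPQ : Disjoint P Q) (W : ℕ → ℕ → ℝ)
    (hW : ∀ n m, W n m = W m n) (z : ℕ → ℝ) :
    ∑ n ∈ P ∪ Q, ∑ m ∈ P ∪ Q, z n * z m * W n m =
      (∑ n ∈ P, ∑ m ∈ P, z n * z m * W n m) + 2 * (∑ m ∈ Q, (∑ n ∈ P, z n * W n m) * z m) +
        ∑ n ∈ Q, ∑ m ∈ Q, z n * z m * W n m := by
  rw [Finset.sum_union hPQ]
  simp_rw [Finset.sum_union hPQ]
  rw [Finset.sum_add_distrib, Finset.sum_add_distrib]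
  have hcross : ∑ n ∈ Q, ∑ m ∈ P, z n * z m * W n m = ∑ m ∈ Q, (∑ n ∈ P, z n * W n m) * z m := by
    refine Finset.sum_congr rfl fun n _ ↦ ?_
    rw [Finset.sum_mul]
    refine Finset.sum_congr rfl fun m _ ↦ ?_
    rw [hW]; ring
  have hcross' : ∑ n ∈ P, ∑ m ∈ Q, z n * z m * W n m = ∑ m ∈ Q, (∑ n ∈ P, z n * W n m) * z m := by
    rw [Finset.sum_comm]
    refine Finset.sum_congr rfl fun m _ ↦ ?_
    rw [Finset.sum_mul]
    refine Finset.sum_congr rfl fun n _ ↦ ?_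
    ring
  rw [hcross, hcross']
  ring

/-! ### The reduction -/

/-- **SECTOR REDUCTION at `S = {2}` PROVED** for every sector datum `D` and every window `b`: far coercivity
(`FarCoercivityTwo`) + the column-tail majorant (`ColumnTailTwo`) + `0 < γ ≤ gammaFar` + the certified block step
`xᵀ(U/γ)x ≤ xᵀG_Wx` give `0 ≤ Σ_{n,m ≤ N} x_n x_m W^σ(n,m)` for every `N` and every real `x` (the Schur-complement
step `WeilFormatC.schurStepDiag_nonneg_of_farBound` on block modes `Fin D.dim` and far modes `(M₁, N]`). -/
theorem sectorReductionTwo_holds (D : SectorData) (b : ℝ) : SectorReductionTwo D b := by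
  intro hFar hCol hγ hγ' hBlock N x
  classical
  -- the zero extension of `x` off the modes `≤ N`, the block vector, the coupling coefficients
  obtain ⟨xt, hxt⟩ : ∃ xt : ℕ → ℝ, ∀ n, xt n = if n ∈ sectorModes D.odd N then x n else 0 :=
    ⟨_, fun _ ↦ rfl⟩
  have hx_in : ∀ n ∈ sectorModes D.odd N, xt n = x n := fun n hn ↦ by rw [hxt, if_pos hn]
  have hx_out : ∀ n ∉ sectorModes D.odd N, xt n = 0 := fun n hn ↦ by rw [hxt, if_neg hn]
  obtain ⟨xF, hxF⟩ : ∃ xF : Fin D.dim → ℝ, ∀ i, xF i = xt (D.mode i) := ⟨_, fun _ ↦ rfl⟩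
  obtain ⟨cc, hcc⟩ : ∃ cc : ℕ → ℝ, ∀ m, cc m = ∑ i : Fin D.dim, xF i * col D.odd b (D.mode i) m :=
    ⟨_, fun _ ↦ rfl⟩
  have hPQ := disjoint_sectorModes_Ioc D.odd D.M₁ N
  have hsub := sectorModes_subset_union D.odd D.M₁ N
  -- Step 1: the truncated form as a double sum of the zero extension over `block ∪ far`
  have hform : sectorForm D.odd b N x =
      ∑ n ∈ sectorModes D.odd D.M₁ ∪ Ioc D.M₁ N, ∑ m ∈ sectorModes D.odd D.M₁ ∪ Ioc D.M₁ N,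
        xt n * xt m * gramSector D.odd b n m := by
    unfold sectorForm
    have inner : ∀ n, ∑ m ∈ sectorModes D.odd N, xt n * xt m * gramSector D.odd b n m =
        ∑ m ∈ sectorModes D.odd D.M₁ ∪ Ioc D.M₁ N, xt n * xt m * gramSector D.odd b n m :=
      fun n ↦ Finset.sum_subset hsub fun m _ hm ↦ by rw [hx_out m hm, mul_zero, zero_mul]
    have outer := Finset.sum_subset hsub
      (f := fun n ↦ ∑ m ∈ sectorModes D.odd D.M₁ ∪ Ioc D.M₁ N, xt n * xt m * gramSector D.odd b n m)
      fun n _ hn ↦ Finset.sum_eq_zero fun m _ ↦ by rw [hx_out n hn, zero_mul, zero_mul]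
    rw [← outer]
    refine Finset.sum_congr rfl fun n hn ↦ ?_
    rw [← inner n]
    refine Finset.sum_congr rfl fun m hm ↦ ?_
    rw [hx_in n hn, hx_in m hm]
  -- Step 2: the block part is `xFᵀ G_W xF`
  have hnear : ∑ n ∈ sectorModes D.odd D.M₁, ∑ m ∈ sectorModes D.odd D.M₁, xt n * xt m * gramSector D.odd b n m =
      xF ⬝ᵥ (Matrix.of (blockG D b)) *ᵥ xF := by
    rw [← sum_sum_eq_dotProduct_mulVec,
      ← sum_fin_mode D (fun n ↦ ∑ m ∈ sectorModes D.odd D.M₁, xt n * xt m * gramSector D.odd b n m)]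
    refine Finset.sum_congr rfl fun i _ ↦ ?_
    rw [← sum_fin_mode D (fun m ↦ xt (D.mode i) * xt m * gramSector D.odd b (D.mode i) m)]
    refine Finset.sum_congr rfl fun j _ ↦ ?_
    rw [hxF i, hxF j]
    rfl
  -- Step 3: the coupling coefficients
  have hcross : ∀ m, ∑ n ∈ sectorModes D.odd D.M₁, xt n * gramSector D.odd b n m = cc m := by
    intro m
    rw [hcc, ← sum_fin_mode D (fun n ↦ xt n * gramSector D.odd b n m)]
    refine Finset.sum_congr rfl fun i _ ↦ ?_
    rw [hxF i]
    rfl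
  -- Step 4: the three hypotheses of the Schur step
  have hU : ∑ m : ↥(Finset.Ioc D.M₁ N), cc m.1 ^ 2 / D.γ ≤
      xF ⬝ᵥ (Matrix.of fun i j ↦ tailU D b i j / D.γ) *ᵥ xF := by
    rw [Finset.sum_coe_sort (Finset.Ioc D.M₁ N) (fun m ↦ cc m ^ 2 / D.γ)]
    have h := coupling_le_tailU D b hγ hCol N xF
    simp_rw [hcc]
    exact h
  have hD : ∑ m : ↥(Finset.Ioc D.M₁ N), D.γ * xt m.1 ^ 2 ≤
      ∑ n ∈ Ioc D.M₁ N, ∑ m ∈ Ioc D.M₁ N, xt n * xt m * gramSector D.odd b n m := by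
    rw [Finset.sum_coe_sort (Finset.Ioc D.M₁ N) (fun m ↦ D.γ * xt m ^ 2), ← Finset.mul_sum]
    have h0 : 0 ≤ ∑ m ∈ Ioc D.M₁ N, xt m ^ 2 := Finset.sum_nonneg fun m _ ↦ sq_nonneg _
    calc D.γ * ∑ m ∈ Ioc D.M₁ N, xt m ^ 2 ≤ gammaFar D.odd b D.M₁ * ∑ m ∈ Ioc D.M₁ N, xt m ^ 2 :=
          mul_le_mul_of_nonneg_right hγ' h0
      _ ≤ _ := hFar N xt
  have key := WeilFormatC.schurStepDiag_nonneg_of_farBound (κ := ↥(Finset.Ioc D.M₁ N))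
    (Matrix.of (blockG D b)) (Matrix.of fun i j ↦ tailU D b i j / D.γ) xF
    (fun m ↦ cc m.1) (fun _ ↦ D.γ) (fun m ↦ xt m.1) (fun _ ↦ hγ) hU (hBlock xF) hD
  rw [Finset.sum_coe_sort (Finset.Ioc D.M₁ N) (fun m ↦ cc m * xt m)] at key
  -- Step 5: assemble
  rw [hform, sum_union_sum_union_of_symm _ _ hPQ _ (fun n m ↦ gramSector_symm D.odd b n m) xt, hnear]
  have hc2 : ∑ m ∈ Ioc D.M₁ N, (∑ n ∈ sectorModes D.odd D.M₁, xt n * gramSector D.odd b n m) * xt m =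
      ∑ m ∈ Ioc D.M₁ N, cc m * xt m := Finset.sum_congr rfl fun m _ ↦ by rw [hcross]
  rw [hc2]
  exact key

/-- **THE S = {2} COMPOSITION WITH ENTRY, SPLIT, DICTIONARY AND SECTOR REDUCTION DISCHARGED**
(`(log 2)/2 ≤ b ≤ log 2`): a verified format-C certificate — per sector a checked `PsdDyadic` certificate (P) of the
entrywise-enclosed (E) Schur matrix `schurS` — closes `WeilSemilocalPositivityOn {2} b ∧ b ≤ a*({2})` modulo ONLY
the two analytic L-C3 statements per sector (`FarCoercivityTwo`, `ColumnTailTwo`) and the side condition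
`0 < γ ≤ gammaFar`. -/
theorem le_threshold_of_formatC₄ (hb : 0 < b) (hb1 : Real.log 2 ≤ 2 * b) (hb2 : b ≤ Real.log 2)
    (De Do : SectorData) (hDe : De.odd = false) (hDo : Do.odd = true)
    (hFe : FarCoercivityTwo false b De.M₁) (hTe : ColumnTailTwo De b) (hγe : 0 < De.γ)
    (hγe' : De.γ ≤ gammaFar false b De.M₁)
    (hFo : FarCoercivityTwo true b Do.M₁) (hTo : ColumnTailTwo Do b) (hγo : 0 < Do.γ)
    (hγo' : Do.γ ≤ gammaFar true b Do.M₁)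
    {δe ρe δo ρo : ℤ} {mide Le mido Lo : List (List ℤ)} {ue uo : ℝ}
    (hPe : PsdDyadic.checkPsdMid De.dim δe ρe mide Le = true) (hue : 0 < ue)
    (hEe : EntrywiseEnclosed (schurS De b) mide ρe ue)
    (hPo : PsdDyadic.checkPsdMid Do.dim δo ρo mido Lo = true) (huo : 0 < uo)
    (hEo : EntrywiseEnclosed (schurS Do b) mido ρo uo) :
    WeilSemilocalPositivityOn {2} b ∧ b ≤ weilSemilocalThreshold {2} :=
  -- the dictionary (weil-3's tree theorem, = `dictionaryTwo_holds hb hb2`) is inlined so that this file depends only on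
  -- `le_threshold_of_formatC₂`
  le_threshold_of_formatC₂ hb hb1 De Do hDe hDo
    (fun h ↦ WeilFormatC.weilSemilocalPositivityOn_two_of_window_sum_chi_nonneg hb hb2 fun N c ↦ by
      have h' := h N c
      unfold windowFormTwo trigWindow lam at h'
      exact h')
    hFe hTe hγe hγe' (sectorReductionTwo_holds De b) hFo hTo hγo hγo' (sectorReductionTwo_holds Do b) hPe hue hEe
    hPo huo hEo

end Reduction

end Summit.RiemannHypothesis.RiemannHypothesis.Theorems.S2FormatC

end
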